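import Summits.QuantumFields.BalabanUV.T4Continuum.Spine.NE7c.LiveFactorLCS
import Summits.QuantumFields.BalabanUV.T4Continuum.Spine.NE7b.KeyPatternReading

/-!
# `T4Continuum.Spine.NE7c.LiveFactorLCSWindow` — spine estimate NE7c (node U5b), road (δ): LCS-j's cost–volume ledger under the live
# factor AT WINDOW LEVEL — regime (P): a live component's per-step stability cost is booked over its persistence window against the
# extraction made AT BIRTH, never per step (refuter F363 ∕ τ-ne7bref-g63-1 (1) on file 15 `LiveFactorLCS`)
# (cell `pub-balaban-gaps`, track G2, seat ne8 gen 10, file 18; record `HOME/ne/NE7c.md` §17)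

HONEST FRAMING.  Finite four-torus programme, rung (B)+1 only — NOT infinite volume, NOT a mass gap, NOT the Clay problem, NOT
summit progress, NOT a proof of NE7c (INSTANCE 0∕1, node O) or NE7b.  Nothing of [Bałaban 1983–89] is asserted; real arithmetic over
the abstract tower of `Spine/NE7b/LocalConditionalStability` and one application of its class display.  No `def`; 0 sorry.

WHY (located).  File 15's ledger lemmas `costVolume_live` ∕ `sum_admS_integral_le_of_LCS_live` carry the TERMWISE letter
`b j g ≤ κ·a₁ j g`.  The NE7b refuter's located read (PRICING-NE7b F363, zero weight): that letter is regime-(R)-typed — inhabitable at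
birth steps (print's `q < p` exponent bookkeeping, file 15 §4) and at free steps (`b = 0`), but NOT at PERSISTENCE steps of a live
component in regime (P), where print extracts nothing (`a₁ = 0`) and still pays `b = O(1)M^dR_n^{d+1}d′_n > 0`, booked by (1.80) against
the `2p₀(g_{j(Z)})` extracted AT BIRTH over the window.  THIS FILE gives the live reading in THAT currency: domination asked only of
the SUMS along each pattern history, `Σ b ≤ κ·Σ a₁` — exactly the window ledger's shape (END3's `ledgerA` books `Σ_{j<K}(bA − aA)`) —,
which the termwise letter implies (`window_of_termwise`) and which persistence steps with `a₁ = 0 < b` do not violate.  In print's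
letters the window domination is the (1.80)-induction's located condition p. 385 at live amplitude — KERNEL in file 3
`LiveFactorKappaInduction.locatedCondition385_of_g_small` (the κ_j(Z) recursion absorbs the per-step volume costs into the birth
term below one g⋆(λ₀)); this file does not re-derive it.

WHAT IS PROVED ([folklore]): §1–§2 `surplus_live_window` (`Σ b ≤ κΣ a₁`, `aL ≥ λ₀²a₁` ⟹ `(λ₀² − κ)Σ a₁ ≤ Σ aL − Σ b`), `costVolume_live_window`
(+ print's `c₁ ≤ Σ(a₁ − b)`, `0 ≤ Σ b`, `κ ≤ λ₀²` ⟹ `(λ₀² − κ)c₁ ≤ Σ(aL − b)`), `window_of_termwise` (file 15's letter is the special case),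
`sum_admS_integral_le_of_LCS_live_window` (= `LocalConditionalStability.sum_admS_integral_le_of_LCS` BY NAME at exponents `λ₀²a₁` under the
window-level ledger); §3 `extractionLaws_of_LCS_keyPattern_live` = leaf-02's `KeyPatternLCSJunction.extractionLaws_of_LCS_keyPattern` shape
(IR-104-1's `hread_keyPattern` discharging `hread`) composed with file 15's `extractionLaws_of_LCS_live`: the road's keyed laws ALONG THE
KEY PATTERNS with the ONE live quotient `Π e^{bU − λ₀²a₁}` — END3's `qA` at uniform live tables (imports `Spine/NE7b/KeyPatternReading`
for this).  BY-NAME EFFECT ON THE WALL: NONE.  HONEST DEPENDENCY (cell): continuum YM on T⁴ ⇐ BetaPertH ∧ nine spine estimates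
(0∕9 proved); BetaPertH ⇐ (D1) ∧ (D4) ∧ CAP+tail.
-/

namespace Summit.QuantumFields.BalabanUV.T4Continuum.Spine.NE7c.LiveFactorLCSWindow

open Finset MeasureTheory Real
open Summit.QuantumFields.BalabanUV.T4Continuum.B16HistoryIndexedRepr
open Summit.QuantumFields.BalabanUV.T4Continuum.B16HistoryReprChain
open Summit.QuantumFields.BalabanUV.T4Continuum.NE7b.PrefixExtraction
open Summit.QuantumFields.BalabanUV.T4Continuum.NE7b.LocalConditionalStability
open Summit.QuantumFields.BalabanUV.T4Continuum.Spine.NE7c.LiveFactorLCS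

/-! ## §1 The ledger along a history with window-level domination -/

section Window

variable {P : Type}

/-- **THE LEDGER ALONG A HISTORY WITH WINDOW-LEVEL DOMINATION.**  If ALONG THE HISTORY the summed stability is dominated by `κ`
times the summed extraction profile, `Σ b ≤ κ·Σ a₁` (persistence steps with `a₁ = 0 < b` allowed), and live extraction is
`aL ≥ λ₀²·a₁` termwise, then `(λ₀² − κ)·Σ a₁ ≤ Σ aL − Σ b`. [folklore] -/
theorem surplus_live_window {a₁ b aL : (j : ℕ) → (Fin j → P) → ℝ} {κ lam₀ : ℝ} {K : ℕ} {h : Fin K → P}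
    (hbw : sumAlong b K h ≤ κ * sumAlong a₁ K h) (haL : ∀ j g, lam₀ ^ 2 * a₁ j g ≤ aL j g) :
    (lam₀ ^ 2 - κ) * sumAlong a₁ K h ≤ sumAlong aL K h - sumAlong b K h := by
  have h1 : lam₀ ^ 2 * sumAlong a₁ K h ≤ sumAlong aL K h := by
    rw [← sumAlong_smul]
    exact sumAlong_mono haL K h
  rw [sub_mul]
  linarith

/-- **PRINT's SURPLUS SURVIVES WITH THE FRACTION `λ₀² − κ`, WINDOW FORM**: print's cost–volume constant `c₁ ≤ Σ(a₁ − b)` along the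
history, a non-negative summed stability `0 ≤ Σ b` dominated AT WINDOW LEVEL by `κ·Σ a₁` with `κ ≤ λ₀²`, and live extraction
`aL ≥ λ₀²·a₁` give `(λ₀² − κ)·c₁ ≤ Σ(aL − b)` — no per-step relation between `b` and `a₁` assumed. [folklore] -/
theorem costVolume_live_window {a₁ b aL : (j : ℕ) → (Fin j → P) → ℝ} {κ lam₀ c₁ : ℝ} {K : ℕ} {h : Fin K → P}
    (hκ : κ ≤ lam₀ ^ 2) (hB0 : 0 ≤ sumAlong b K h) (hbw : sumAlong b K h ≤ κ * sumAlong a₁ K h)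
    (haL : ∀ j g, lam₀ ^ 2 * a₁ j g ≤ aL j g) (hc : c₁ ≤ sumAlong a₁ K h - sumAlong b K h) :
    (lam₀ ^ 2 - κ) * c₁ ≤ sumAlong aL K h - sumAlong b K h := by
  have hA : c₁ ≤ sumAlong a₁ K h := by linarith
  exact (mul_le_mul_of_nonneg_left hA (sub_nonneg.2 hκ)).trans (surplus_live_window hbw haL)

/-- File 15's termwise letter is the special case: `b ≤ κ·a₁` termwise gives the window-level domination. [folklore] -/
theorem window_of_termwise {a₁ b : (j : ℕ) → (Fin j → P) → ℝ} {κ : ℝ} (hb : ∀ j g, b j g ≤ κ * a₁ j g)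
    (K : ℕ) (h : Fin K → P) : sumAlong b K h ≤ κ * sumAlong a₁ K h := by
  rw [← sumAlong_smul]
  exact sumAlong_mono hb K h

/-- (S) a decided instance of the regime-(P) pattern the termwise letter misses: two steps, extraction `a₁ = (8, 0)` (birth, then
persistence), stability `b = (1, 1)`: termwise `b ≤ κ·a₁` FAILS at the second step for every `κ` (`1 ≤ κ·0` is false), while at window
level `Σ b = 2 ≤ ¼·8 = κ·Σ a₁` with `κ = ¼`. [folklore] -/
example : ¬ ((1 : ℝ) ≤ (1 / 4 : ℝ) * 0) ∧ ((1 : ℝ) + 1 ≤ (1 / 4 : ℝ) * (8 + 0)) := by norm_num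

end Window

/-! ## §2 The class display at the live letters under the window-level ledger -/

section ClassBoundWindow

variable {P : Type} [DecidableEq P] {C : ℕ → Type} {𝒢 : (j : ℕ) → GoodClass (C j)} {T : Tower P C 𝒢}
  {S : (j : ℕ) → (Fin j → P) → Finset P} [∀ j, MeasurableSpace (C j)] {μ : (j : ℕ) → Measure (C j)} {ρ₀ : C 0 → ℝ}
  {K : ℕ} {χ : (j : ℕ) → (Fin j → P) → P → C j → ℝ} {M : (j : ℕ) → (Fin j → P) → C j → ℝ}
  {a a₁ b : (j : ℕ) → (Fin j → P) → ℝ}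

/-- **THE CLASS DISPLAY FROM «LCS-j» AT THE LIVE LETTERS, WINDOW FORM** (regime (P)-compatible): as file 15's
`sum_admS_integral_le_of_LCS_live` with the termwise `b ≤ κ·a₁` replaced by the window-level domination `Σ b ≤ κ·Σ a₁` along every
pattern history (and `0 ≤ Σ b` there): ONE tower with its `hstep` ∕ `hintχ` displays, `0 ≤ M`, PE with `a ≥ λ₀²a₁` on the prefixes,
LCS with `b`, `κ ≤ λ₀²`, print's `c₁ ≤ Σ(a₁ − b)` ⟹ `Σ_{h ∈ admS} ∫ eterm K h dμ_K ≤ e^{−(λ₀² − κ)c₁}·∫ ρ₀ dμ_0` —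
`LocalConditionalStability.sum_admS_integral_le_of_LCS` BY NAME at exponents `λ₀²·a₁`. [folklore] -/
theorem sum_admS_integral_le_of_LCS_live_window (hρ : (𝒢 0).Gd ρ₀) (h0 : ∀ x, 0 ≤ ρ₀ x)
    (hstep : ∀ j g, j < K → g ∈ admS T S j → ∀ p ∈ T.branch j g, ∀ f : C j → ℝ, (𝒢 j).Gd f →
      ∫ x, (T.op j g p).T f x ∂μ (j + 1) = ∫ y, χ j g p y * f y ∂μ j)
    (hintχ : ∀ j g, j < K → g ∈ admS T S j → ∀ p ∈ T.branch j g,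
      Integrable (fun y => χ j g p y * T.eterm ρ₀ j g y) (μ j))
    (hM : ∀ j g y, 0 ≤ M j g y) (hPE : PointwiseExtraction T S K χ M a) (hLCS : LocCondStability T S K μ ρ₀ M b)
    {lam₀ κ c₁ : ℝ} (hκ : κ ≤ lam₀ ^ 2) (ha : ∀ j g, j < K → g ∈ admS T S j → lam₀ ^ 2 * a₁ j g ≤ a j g)
    (hB0 : ∀ h ∈ admS T S K, 0 ≤ sumAlong b K h)
    (hbw : ∀ h ∈ admS T S K, sumAlong b K h ≤ κ * sumAlong a₁ K h)
    (hcost : ∀ h ∈ admS T S K, c₁ ≤ sumAlong a₁ K h - sumAlong b K h) :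
    ∑ h ∈ admS T S K, ∫ x, T.eterm ρ₀ K h x ∂μ K ≤ exp (-((lam₀ ^ 2 - κ) * c₁)) * ∫ x, ρ₀ x ∂μ 0 :=
  sum_admS_integral_le_of_LCS hρ h0 hstep hintχ (pointwiseExtraction_live hM ha hPE) hLCS fun h hh =>
    costVolume_live_window hκ (hB0 h hh) (hbw h hh) (fun _ _ => le_rfl) (hcost h hh)

end ClassBoundWindow

/-! ## §3 The road's keyed laws from LCS-j ALONG THE KEY PATTERNS at the live letters (`hread` discharged by IR-104-1) -/

section KeyPatternLive

open Literature.MathematicalPhysics.QuantumFieldTheory.Balaban1983to89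
open Literature.MathematicalPhysics.QuantumFieldTheory.Balaban1983to89.T4LiveClassFibration
open Literature.MathematicalPhysics.QuantumFieldTheory.Balaban1983to89.T4PersistenceDictionary
open Literature.MathematicalPhysics.QuantumFieldTheory.Balaban1983to89.B13ScaleTransfer
open Summit.QuantumFields.BalabanUV.T4Continuum.B16HistoryReprInstance
open Summit.QuantumFields.BalabanUV.T4Continuum.B16HistoryReprReadCausal
open Summit.QuantumFields.BalabanUV.T4Continuum.HistoryAssemblyMult
open Summit.QuantumFields.BalabanUV.T4Continuum.HistoryRealiseCellsRunAssemblyWTVSData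
open Summit.QuantumFields.BalabanUV.T4Continuum.HistoryGenealogyInstantiate
open Summit.QuantumFields.BalabanUV.T4Continuum.NE7b.PinnedExtraction
open Summit.QuantumFields.BalabanUV.T4Continuum.NE7b.PrefixExtractionLaws
open Summit.QuantumFields.BalabanUV.T4Continuum.NE7b.KeyPatternReading

variable {P : Type} [DecidableEq P] {d : ℕ} (𝒮 : StepReading P d) {C : ℕ → ℕ → Type} {𝒢 : (K j : ℕ) → GoodClass (C K j)}
  (T : (K : ℕ) → Tower P (C K) (𝒢 K)) (p₀ : ℕ → ℕ → P) (n L : ℕ) (hn : 0 < n) (hL : 0 < L)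
  (ρ₀ : (K : ℕ) → ℝ → C K 0 → ℝ) (hρ : ∀ K t, (𝒢 K 0).Gd (ρ₀ K t)) (h0 : ∀ K t x, 0 ≤ ρ₀ K t x)
  (B : ℕ → ℝ → ℝ) (hB : ∀ K t, 0 < B K t) [∀ K j, MeasurableSpace (C K j)] (ν : (K j : ℕ) → Measure (C K j))

/-- **THE ROAD's KEYED EXTRACTION LAWS FROM «LCS-j» ALONG THE KEY PATTERNS, AT THE LIVE LETTERS** — leaf-02's
`KeyPatternLCSJunction.extractionLaws_of_LCS_keyPattern` (IR-104-1's `hread_keyPattern` discharging `hread`) composed with file 15's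
`extractionLaws_of_LCS_live`: for ONE cutoff family of towers (the lowered-threshold run at some grid assignment) with its `hstep` ∕
integrability displays, PE ∕ LCS along the KEY PATTERNS of the bad keys with exponent tables `a b`, carriers `M ≥ 0`, and assignment-free
tables `a₁ bU` with `λ₀²·a₁ ≤ a`, `b ≤ bU` on the bad keys, the road's `ExtractionLaws` hold over the key fibres with the ONE quotient
`Π_{j<K} e^{bU K k j − λ₀²·a₁ K k j}` — END3's `qA` at the uniform live tables, the same for every assignment (the key carriers read
`branch` only, file 14).  Nothing of Bałaban's discharged. [folklore] -/
theorem extractionLaws_of_LCS_keyPattern_live {l₀ : ℝ} (hν0 : ∀ K j g, 𝒮.ν K j g (p₀ K j) = ∅) {jstar : ℕ → ℕ}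
    (Bad : ℕ → ℝ → Finset (HIndex.Idx (skelFam T p₀)))
    (X : ℕ → Finset (Finset ((Fin d → ℕ) × Gen PEv × Multiset (PEv × ((Fin d → ℕ) × Finset (Pt d))))))
    (hX : ∀ K, X K ⊆ badGMems (memA n L (𝒮.reading T p₀)) jstar (HIndex.termSet (skelFam T p₀))
      (kmemA n L hn hL (𝒮.reading T p₀)) K)
    (χ : (K : ℕ) → Finset ((Fin d → ℕ) × Gen PEv × Multiset (PEv × ((Fin d → ℕ) × Finset (Pt d)))) →
      (j : ℕ) → (Fin j → P) → P → C K j → ℝ)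
    (M : (K : ℕ) → Finset ((Fin d → ℕ) × Gen PEv × Multiset (PEv × ((Fin d → ℕ) × Finset (Pt d)))) →
      ℝ → (j : ℕ) → (Fin j → P) → C K j → ℝ)
    (a b : ℕ → Finset ((Fin d → ℕ) × Gen PEv × Multiset (PEv × ((Fin d → ℕ) × Finset (Pt d)))) → ℕ → ℝ)
    (hp₀ : ∀ K j g, p₀ K j ∈ (T K).branch j g)
    (bad_subset : ∀ K t, |t| ≤ l₀ → Bad K t ⊆ HIndex.termSet (skelFam T p₀) K)
    (cover : ∀ K t, |t| ≤ l₀ → ∀ τ ∈ Bad K t, ∃ k ∈ X K,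
      τ ∈ fibre (kmemA n L hn hL (𝒮.reading T p₀)) (HIndex.termSet (skelFam T p₀)) K k)
    (hstep : ∀ K t, |t| ≤ l₀ → ∀ k ∈ X K, ∀ j g, j < K →
      g ∈ admS (T K) (keyPattern T p₀ (kmemA n L hn hL (𝒮.reading T p₀)) K k) j → ∀ p ∈ (T K).branch j g,
      ∀ f : C K j → ℝ, (𝒢 K j).Gd f → ∫ y, ((T K).op j g p).T f y ∂ν K (j + 1) = ∫ y, χ K k j g p y * f y ∂ν K j)
    (hintχ : ∀ K t, |t| ≤ l₀ → ∀ k ∈ X K, ∀ j g, j < K →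
      g ∈ admS (T K) (keyPattern T p₀ (kmemA n L hn hL (𝒮.reading T p₀)) K k) j → ∀ p ∈ (T K).branch j g,
      Integrable (fun y => χ K k j g p y * (T K).eterm (ρ₀ K t) j g y) (ν K j))
    (hPE : ∀ K t, |t| ≤ l₀ → ∀ k ∈ X K,
      PointwiseExtraction (T K) (keyPattern T p₀ (kmemA n L hn hL (𝒮.reading T p₀)) K k) K (χ K k) (M K k t)
        (fun j _ => a K k j))
    (hLCS : ∀ K t, |t| ≤ l₀ → ∀ k ∈ X K,
      LocCondStability (T K) (keyPattern T p₀ (kmemA n L hn hL (𝒮.reading T p₀)) K k) K (ν K) (ρ₀ K t) (M K k t)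
        (fun j _ => b K k j))
    (hint : ∀ K t, |t| ≤ l₀ → ∀ j g, j < K → g ∈ (T K).adm j → Integrable ((T K).eterm (ρ₀ K t) j g) (ν K j))
    (hint' : ∀ K t, |t| ≤ l₀ → ∀ j g p, j < K → g ∈ (T K).adm j → p ∈ (T K).branch j g →
      Integrable (((T K).op j g p).T ((T K).eterm (ρ₀ K t) j g)) (ν K (j + 1)))
    (hpres : ∀ K t, |t| ≤ l₀ → ∀ j g, j < K → g ∈ (T K).adm j →
      ∫ x, (∑ p ∈ (T K).branch j g, ((T K).op j g p).T ((T K).eterm (ρ₀ K t) j g) x) ∂ν K (j + 1) =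
        ∫ x, (T K).eterm (ρ₀ K t) j g x ∂ν K j)
    (hintM : ∀ K t, |t| ≤ l₀ → ∀ a', ∀ ι ∈ (skelFam T p₀ K).LIdx a',
      Integrable ((reprFam T p₀ ρ₀ hρ h0 B hB K t).eterm a' ι) (ν K K))
    {lam₀ : ℝ} (a₁ bU : ℕ → Finset ((Fin d → ℕ) × Gen PEv × Multiset (PEv × ((Fin d → ℕ) × Finset (Pt d)))) → ℕ → ℝ)
    (hM : ∀ K k t j g y, 0 ≤ M K k t j g y)
    (ha : ∀ K, ∀ k ∈ X K, ∀ j, j < K → lam₀ ^ 2 * a₁ K k j ≤ a K k j)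
    (hb : ∀ K, ∀ k ∈ X K, ∀ j, j < K → b K k j ≤ bU K k j) :
    ExtractionLaws l₀ (HIndex.termSet (skelFam T p₀))
      (fun _ t => Repr172R.weight (I := skelFam T p₀) (fun K => ν K K) (reprFam T p₀ ρ₀ hρ h0 B hB) t)
      Bad X (fun K k => fibre (kmemA n L hn hL (𝒮.reading T p₀)) (HIndex.termSet (skelFam T p₀)) K k)
      (fun K k => ∏ j ∈ Finset.range K, exp (bU K k j - lam₀ ^ 2 * a₁ K k j)) :=
  extractionLaws_of_LCS_live T p₀ ρ₀ hρ h0 B hB ν (keyPattern T p₀ (kmemA n L hn hL (𝒮.reading T p₀))) χ M a b Bad X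
    (fun K k => fibre (kmemA n L hn hL (𝒮.reading T p₀)) (HIndex.termSet (skelFam T p₀)) K k) hp₀ bad_subset cover
    (hread_keyPattern 𝒮 T p₀ n L hn hL hν0 hX) hstep hintχ hPE hLCS hint hint' hpres hintM a₁ bU hM ha hb

end KeyPatternLive

end Summit.QuantumFields.BalabanUV.T4Continuum.Spine.NE7c.LiveFactorLCSWindow
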